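import Mathlib
import Summits.NavierStokesRegularity.NavierStokesRegularity.Theorems.LerayQuarterDissipationFiniteDissipationLiouvilleVorticityAmplitudeStretching
import HarnessLib

/-!
# Crux `FiniteDissipationLiouville` (stmt-NavierStokesRegularity-22144): the VORTICITY-AMPLITUDE
# threshold — a finite-dissipation Type-I profile with `(−t)‖ω(t,x)‖ < √3/4` everywhere is trivial
# (file 3/3)

Theorems file of route `LerayQuarterDissipation` (lead prover g15; `--supports` the crux; portrait
fact for the registered stub `stub_envelopeCriticalLiouville` of skeleton `Lines/birth.lean`).
Navier–Stokes regularity is NOT proved by anything here; no summit is.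

`𝒟_{C,K}`: Type-I ancient mild fields `V` in the KNSS gauge (`IsTypeIAncientMild C V`: smooth on
`t < 0`, divergence free, Oseen-mild, `‖V(t,x)‖ ≤ C/√(−t)`) whose slices obey the quarter-rate
dissipation law `∫ ‖DV(t)‖² ≤ K/√(−t)`. Besides `C` (velocity) and `K` (dissipation) the stratum
carries a third scale-invariant amplitude, the VORTICITY constant
`C_ω = sup_{t<0, x} (−t)‖curl V(t,x)‖` — in similarity variables `sup_{s,y} ‖Ω(s,y)‖`,
`Ω = lerayVorticity V = curl (lerayOrbit V)` (`curl_lerayOrbit`). This file proves the EXPLICIT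
rung in that parameter:

* (file 1/3 `…VorticityAmplitudeTools`: the whole-space `div`–`curl` identity for `L⁶` fields
  with `L²` gradient, hence `∫ |DU(s)|²_F = ∫ ‖Ω(s)‖²` on the stratum; file 2/3
  `…VorticityAmplitudeStretching`: the trace-free stretching inequality
  `3⟪DUΩ,Ω⟫² ≤ (2|DU|²_F − ‖curl U‖²)‖Ω‖⁴` and the stretching term priced by the vorticity amplitude,
  `2∫φ_R²⟪DU Ω, Ω⟫ ≤ (2/√3) C_ω ∫‖Ω(s)‖²`;)
* `integral_sq_norm_lerayVorticity_le_of_forall_le` — under any LINEAR stretching bound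
  `2∫φ_R²⟪DU Ω, Ω⟫ ≤ κ Z_∞` the budget `Z_R' ≤ −½Z_R + κ m + LM/R` (`m` any uniform bound of the
  global enstrophy `Z_∞(s) = ∫‖Ω(s)‖²`, dissipation discarded), the backward ODE bound for the
  ANCIENT orbit (`le_div_of_deriv_le_neg_mul_add`) and `R → ∞` improve `m` to `2κ m`;
* `lerayVorticity_eq_zero_of_vorticity_lt`, **`eq_zero_of_vorticity_lt`** — iterating with
  `κ = (2/√3)C_ω`: `Z_∞ ≤ (4C_ω/√3)ⁿ M → 0`: **a member of `𝒟_{C,K}` (any `C`, any `K`) with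
  `(−t)‖curl V(t,x)‖ ≤ C_ω < √3/4` for all `t < 0`, `x` vanishes identically on `t < 0`**;
* `not_singular_of_vorticity_lt`, **`vorticity_exceeds_of_singular`** — regularity form and
  PORTRAIT: a SINGULAR member of the stratum has `(−t)‖curl V(t,x)‖ > C_ω` somewhere, for every
  `C_ω < √3/4 ≈ 0.433` — the vorticity analogue of the velocity threshold `√(−t)‖V‖ ≥ 1`
  (`…SimilarityEnstrophy.typeI_ancient_eq_zero_of_rate_lt_one`, `…Amplitude`, `…ThresholdOne`) and
  of the dissipation threshold (`…SmallDissipationGap`, `…ThresholdK`).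

HONEST FRAMING. An explicit necessary condition on the HYPOTHETICAL singular profile; the constant
`√3/4` is what the energy method with the sharp pointwise kinematics gives (the dissipation
`−2∫φ²|∇Ω|²` is simply discarded) and is not claimed sharp (BKM-type arguments give `‖ω(t)‖_∞ ≳ (T−t)⁻¹` at a blow-up without an explicit
constant); nothing is removed from the catalogued DSS wall (`TypeIDSSLiouville`, NECESSARY for the
crux); nothing here bears on Navier–Stokes regularity or blow-up.

References: Koch–Nadirashvili–Seregin–Šverák, Acta Math. 203 (2009) §4–§6 (the class, the gauge);
Doering–Gibbon 1995 §1.4 (1.4.20)–(1.4.21) and Majda–Bertozzi 2002 Prop. 2.16 (`div`–`curl`);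
Beale–Kato–Majda, Comm. Math. Phys. 94 (1984) (vorticity controls blow-up); folklore energy method.
-/

noncomputable section

set_option linter.dupNamespace false

namespace Summit.NavierStokesRegularity.NavierStokesRegularity.Theorems.FiniteDissipationLiouville.VorticityAmplitude

open MeasureTheory Set Filter Topology Metric InnerProductSpace Function Real
open scoped RealInnerProductSpace ContDiff ENNReal Laplacian
open Literature.Analysis Literature.Analysis.FluidPDE
open Summit.NavierStokesRegularity.NavierStokesRegularity.Theorems
open Summit.NavierStokesRegularity.NavierStokesRegularity.Theorems.GaussianGap
open Summit.NavierStokesRegularity.NavierStokesRegularity.Theorems.SimilarityEnstrophy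
open Summit.NavierStokesRegularity.NavierStokesRegularity.Theorems.SmallDissipationGap

variable {C : ℝ} {V : ℝ → (EuclideanSpace ℝ (Fin 3)) → (EuclideanSpace ℝ (Fin 3))}


/-! ### The budget: under a linear stretching bound a uniform enstrophy bound `m` improves to `2κ m` -/

section Budget

/-- **One turn of the screw.** Let `V ∈ 𝒟_{C,K}` and suppose the stretching term of the
squared-cutoff similarity-enstrophy budget is bounded LINEARLY by the global enstrophy,
`2∫φ_R²⟪DU Ω, Ω⟫(σ) ≤ κ ∫‖Ω(σ)‖²` for all `σ` and all `R > 0` (`κ ≥ 0`; e.g. `κ = (2/√3)C_ω` under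
the vorticity bound `‖Ω‖ ≤ C_ω`, `two_mul_integral_sqCutoff_stretching_le_sharp`), and that
`∫ ‖Ω(σ)‖² ≤ m` for all `σ`. Then `∫ ‖Ω(s)‖² ≤ 2κ m` for all `s`: the squared-cutoff enstrophy
identity (`deriv_sqCutoffEnstrophy_eq`) with the drift flux signed, the transport and viscous fluxes
priced by the collar mass `≤ M = ‖curlCLM‖² max K 0` and the dissipation DISCARDED gives
`Z_R' ≤ −½ Z_R + κ m + LM/R`; the backward ODE bound for the ANCIENT orbit
(`le_div_of_deriv_le_neg_mul_add`) gives `Z_R ≤ 2κ m + 2LM/R`, and `R → ∞`. [folklore energy method] -/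
theorem integral_sq_norm_lerayVorticity_le_of_forall_le (hV : IsTypeIAncientMild C V) {K : ℝ}
    (hK : ∀ t : ℝ, t < 0 → ∫⁻ x, ‖fderiv ℝ (V t) x‖ₑ ^ 2 ≤ ENNReal.ofReal (K / Real.sqrt (-t)))
    {κ : ℝ} (hκ : 0 ≤ κ)
    (hstr : ∀ σ : ℝ, ∀ R : ℝ, 0 < R →
      2 * (∫ y, smoothTransition (2 - ‖y‖ ^ 2 / R ^ 2) ^ 2 *
        ⟪fderiv ℝ (lerayOrbit V σ) y (lerayVorticity V σ y), lerayVorticity V σ y⟫) ≤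
        κ * ∫ y, ‖lerayVorticity V σ y‖ ^ 2)
    {m : ℝ} (hm : ∀ s, ∫ y, ‖lerayVorticity V s y‖ ^ 2 ≤ m) (s : ℝ) :
    ∫ y, ‖lerayVorticity V s y‖ ^ 2 ≤ 2 * κ * m := by
  obtain ⟨c₁, hc₁0, hc₁⟩ :=
    exists_norm_fderiv_smoothTransition_cutoff_le (E := (EuclideanSpace ℝ (Fin 3)))
  obtain ⟨c₂, hc₂0, hc₂⟩ :=
    exists_abs_laplacian_smoothTransition_cutoff_le (E := (EuclideanSpace ℝ (Fin 3)))
  have hC : 0 ≤ C := hV.nonneg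
  have hΩi := fun σ => integrable_sq_norm_lerayVorticity hV hK σ
  set M : ℝ := ‖curlCLM‖ ^ 2 * max K 0 with hMdef
  have hM0 : 0 ≤ M := by positivity
  have hm0 : 0 ≤ m := (integral_nonneg fun y => sq_nonneg _).trans (hm s)
  set L : ℝ := 2 * C * c₁ + 2 * c₂ + 6 * c₁ ^ 2 with hLdef
  have hL0 : 0 ≤ L := by positivity
  -- Step 1: `Z_R(σ) ≤ (κ m + L M / R) / (1/2)` for every `R ≥ 1`, `σ`
  have hZ : ∀ R : ℝ, 1 ≤ R → ∀ σ : ℝ,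
      (∫ y, smoothTransition (2 - ‖y‖ ^ 2 / R ^ 2) ^ 2 * ‖lerayVorticity V σ y‖ ^ 2) ≤
        (κ * m + L / R * M) / (1 / 2) := by
    intro R hR1
    have hR : 0 < R := lt_of_lt_of_le one_pos hR1
    have hd : Differentiable ℝ fun σ =>
        ∫ y, smoothTransition (2 - ‖y‖ ^ 2 / R ^ 2) ^ 2 * ‖lerayVorticity V σ y‖ ^ 2 :=
      fun σ => (hasDerivAt_sqCutoffEnstrophy hV hR σ).differentiableAt
    have hle : ∀ σ, (∫ y, smoothTransition (2 - ‖y‖ ^ 2 / R ^ 2) ^ 2 * ‖lerayVorticity V σ y‖ ^ 2) ≤ M := by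
      intro σ
      calc (∫ y, smoothTransition (2 - ‖y‖ ^ 2 / R ^ 2) ^ 2 * ‖lerayVorticity V σ y‖ ^ 2)
          ≤ ∫ y, ‖lerayVorticity V σ y‖ ^ 2 := by
            refine integral_mono_of_nonneg (Eventually.of_forall fun y =>
              mul_nonneg (sq_nonneg _) (sq_nonneg _)) (hΩi σ).1 (Eventually.of_forall fun y => ?_)
            have h1 := sqCutoff_le_one R y
            have h0 : 0 ≤ ‖lerayVorticity V σ y‖ ^ 2 := sq_nonneg _
            nlinarith
        _ ≤ M := (hΩi σ).2
    have hI : ∀ σ, (∫ y in closedBall (0 : EuclideanSpace ℝ (Fin 3)) (2 * R), ‖lerayVorticity V σ y‖ ^ 2) ≤ M :=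
      fun σ => (setIntegral_le_integral (hΩi σ).1 (Eventually.of_forall fun y => sq_nonneg _)).trans (hΩi σ).2
    have hZ' : ∀ σ, deriv (fun σ' =>
        ∫ y, smoothTransition (2 - ‖y‖ ^ 2 / R ^ 2) ^ 2 * ‖lerayVorticity V σ' y‖ ^ 2) σ ≤
        -(1 / 2) * (∫ y, smoothTransition (2 - ‖y‖ ^ 2 / R ^ 2) ^ 2 * ‖lerayVorticity V σ y‖ ^ 2) +
          (κ * m + L / R * M) := by
      intro σ
      rw [deriv_sqCutoffEnstrophy_eq hV hR σ]
      set φ : (EuclideanSpace ℝ (Fin 3)) → ℝ := fun z => smoothTransition (2 - ‖z‖ ^ 2 / R ^ 2) with hφdef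
      set Ω := lerayVorticity V σ with hΩdef
      set U := lerayOrbit V σ with hUdef
      set I : ℝ := ∫ y in closedBall (0 : (EuclideanSpace ℝ (Fin 3))) (2 * R), ‖Ω y‖ ^ 2 with hIdef
      have hI0 : 0 ≤ I := integral_nonneg fun y => sq_nonneg _
      have hIM : I ≤ M := hI σ
      have hD0 : 0 ≤ ∫ y, φ y ^ 2 * frobeniusNormSq (fderiv ℝ Ω y) :=
        integral_nonneg fun y => mul_nonneg (sq_nonneg _) (frobeniusNormSq_nonneg _)
      have hΩ1 : ContDiff ℝ 1 Ω := signedBudget_contDiff_lerayVorticity_slice hV σ (n := 1)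
      have hcΩ : Continuous Ω := hΩ1.continuous
      have hUC : ∀ y, ‖U y‖ ≤ C := fun y => norm_lerayOrbit_le_of_typeI hV σ y
      have hw1 : ContDiff ℝ 1 fun z : (EuclideanSpace ℝ (Fin 3)) => φ z ^ 2 := contDiff_sqCutoff (n := 1) R
      have hw2 : ContDiff ℝ 2 fun z : (EuclideanSpace ℝ (Fin 3)) => φ z ^ 2 := contDiff_sqCutoff (n := 2) R
      have hcDw : Continuous (fderiv ℝ fun z : (EuclideanSpace ℝ (Fin 3)) => φ z ^ 2) :=
        hw1.continuous_fderiv one_ne_zero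
      -- (1) drift flux `≤ 0`
      have hDrift : (∫ y, fderiv ℝ (fun z : (EuclideanSpace ℝ (Fin 3)) => φ z ^ 2) y y * ‖Ω y‖ ^ 2) ≤ 0 :=
        integral_nonpos fun y => mul_nonpos_iff.2 (Or.inr ⟨fderiv_sqCutoff_self_nonpos R y, sq_nonneg _⟩)
      -- (2) transport flux
      have hT : |∫ y, fderiv ℝ (fun z : (EuclideanSpace ℝ (Fin 3)) => φ z ^ 2) y (U y) * ‖Ω y‖ ^ 2| ≤
          C * (2 * (c₁ / R)) * I := by
        refine abs_integral_le_of_weight_sq hcΩ (w := fun y => C * ‖fderiv ℝ (fun z : (EuclideanSpace ℝ (Fin 3)) => φ z ^ 2) y‖)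
          (continuous_const.mul hcDw.norm) (fun y hy => ?_) (fun y _ => ?_) (fun y => ?_)
        · show C * ‖fderiv ℝ (fun z : (EuclideanSpace ℝ (Fin 3)) => φ z ^ 2) y‖ = 0
          rw [hφdef, fderiv_sqCutoff_eq_zero hR hy, norm_zero, mul_zero]
        · exact mul_le_mul_of_nonneg_left (norm_fderiv_sqCutoff_le hc₁ hR y) hC
        · rw [abs_mul, abs_of_nonneg (sq_nonneg ‖Ω y‖)]
          have e1 : |fderiv ℝ (fun z : (EuclideanSpace ℝ (Fin 3)) => φ z ^ 2) y (U y)| ≤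
              ‖fderiv ℝ (fun z : (EuclideanSpace ℝ (Fin 3)) => φ z ^ 2) y‖ * C := by
            rw [← Real.norm_eq_abs]
            exact (ContinuousLinearMap.le_opNorm _ _).trans
              (mul_le_mul_of_nonneg_left (hUC y) (norm_nonneg _))
          calc |fderiv ℝ (fun z : (EuclideanSpace ℝ (Fin 3)) => φ z ^ 2) y (U y)| * ‖Ω y‖ ^ 2
              ≤ (‖fderiv ℝ (fun z : (EuclideanSpace ℝ (Fin 3)) => φ z ^ 2) y‖ * C) * ‖Ω y‖ ^ 2 :=
                mul_le_mul_of_nonneg_right e1 (sq_nonneg _)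
            _ = C * ‖fderiv ℝ (fun z : (EuclideanSpace ℝ (Fin 3)) => φ z ^ 2) y‖ * ‖Ω y‖ ^ 2 := by ring
      -- (3) viscous flux
      have hVisc : |∫ y, ‖Ω y‖ ^ 2 * (Δ (fun z : (EuclideanSpace ℝ (Fin 3)) => φ z ^ 2)) y| ≤
          (2 * (c₂ / R ^ 2) + 6 * (c₁ / R) ^ 2) * I := by
        refine abs_integral_le_of_weight_sq hcΩ (w := fun y => |(Δ (fun z : (EuclideanSpace ℝ (Fin 3)) => φ z ^ 2)) y|)
          (continuous_laplacian hw2).abs (fun y hy => ?_) (fun y _ => ?_) (fun y => ?_)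
        · show |(Δ (fun z : (EuclideanSpace ℝ (Fin 3)) => φ z ^ 2)) y| = 0
          rw [hφdef, laplacian_sqCutoff_eq_zero hR hy, abs_zero]
        · exact abs_laplacian_sqCutoff_le hc₁ hc₂ hR y
        · rw [abs_mul, abs_of_nonneg (sq_nonneg ‖Ω y‖), mul_comm]
      -- (4) stretching, linear in the global enstrophy by hypothesis
      have hS := hstr σ R hR
      have hSm : κ * ∫ y, ‖lerayVorticity V σ y‖ ^ 2 ≤ κ * m :=
        mul_le_mul_of_nonneg_left (hm σ) hκ
      -- absorption
      have hT' := (le_abs_self _).trans hT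
      have hVisc' := (le_abs_self _).trans hVisc
      have hR2 : 1 / R ^ 2 ≤ 1 / R := by
        rw [div_le_div_iff₀ (by positivity) hR]
        nlinarith
      have hc₂R : c₂ / R ^ 2 ≤ c₂ / R := by
        have := mul_le_mul_of_nonneg_left hR2 hc₂0
        simpa only [mul_one_div] using this
      have hc₁R : (c₁ / R) ^ 2 ≤ c₁ ^ 2 / R := by
        rw [div_pow]
        have := mul_le_mul_of_nonneg_left hR2 (sq_nonneg c₁)
        simpa only [mul_one_div] using this
      have a1 : C * (2 * (c₁ / R)) * I ≤ C * (2 * (c₁ / R)) * M :=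
        mul_le_mul_of_nonneg_left hIM (by positivity)
      have a2 : (2 * (c₂ / R ^ 2) + 6 * (c₁ / R) ^ 2) * I ≤ (2 * (c₂ / R) + 6 * (c₁ ^ 2 / R)) * M :=
        (mul_le_mul_of_nonneg_right (by linarith [hc₂R, hc₁R]) hI0).trans
          (mul_le_mul_of_nonneg_left hIM (by positivity))
      have e : L / R * M = C * (2 * (c₁ / R)) * M + (2 * (c₂ / R) + 6 * (c₁ ^ 2 / R)) * M := by
        rw [hLdef]; field_simp; ring
      rw [e]
      linarith [hDrift, hT', hVisc', hS, hSm, hD0, a1, a2]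
    exact le_div_of_deriv_le_neg_mul_add hd ⟨M, hle⟩ (by norm_num : (0:ℝ) < 1 / 2) hZ'
  -- Step 2: `∫_{B̄_n} ‖Ω(s)‖² ≤ (κ m + L M / n)/(1/2)`, and `n → ∞`
  have hcΩ : Continuous (lerayVorticity V s) :=
    (signedBudget_contDiff_lerayVorticity_slice hV s (n := 1)).continuous
  have hball : ∀ n : ℕ, 1 ≤ (n : ℝ) →
      (∫ y in closedBall (0 : EuclideanSpace ℝ (Fin 3)) n, ‖lerayVorticity V s y‖ ^ 2) ≤
        (κ * m + L / n * M) / (1 / 2) := by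
    intro n hn
    have hR : 0 < (n : ℝ) := lt_of_lt_of_le one_pos hn
    refine le_trans ?_ (hZ n hn s)
    have hint : Integrable fun y => smoothTransition (2 - ‖y‖ ^ 2 / (n : ℝ) ^ 2) ^ 2 *
        ‖lerayVorticity V s y‖ ^ 2 :=
      (((contDiff_sqCutoff (n := 1) (n : ℝ)).continuous).mul (hcΩ.norm.pow 2)).integrable_of_hasCompactSupport
        ((hasCompactSupport_sqCutoff hR).mul_right)
    calc (∫ y in closedBall (0 : EuclideanSpace ℝ (Fin 3)) n, ‖lerayVorticity V s y‖ ^ 2)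
        = ∫ y in closedBall (0 : EuclideanSpace ℝ (Fin 3)) n,
            smoothTransition (2 - ‖y‖ ^ 2 / (n : ℝ) ^ 2) ^ 2 * ‖lerayVorticity V s y‖ ^ 2 := by
          refine setIntegral_congr_fun measurableSet_closedBall fun y hy => ?_
          rw [mem_closedBall, dist_zero_right] at hy
          rw [sqCutoff_eq_one hR hy, one_mul]
      _ ≤ ∫ y, smoothTransition (2 - ‖y‖ ^ 2 / (n : ℝ) ^ 2) ^ 2 * ‖lerayVorticity V s y‖ ^ 2 :=
          setIntegral_le_integral hint (Eventually.of_forall fun y =>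
            mul_nonneg (sq_nonneg _) (sq_nonneg _))
  have hlim : Tendsto (fun n : ℕ =>
      ∫ y in closedBall (0 : EuclideanSpace ℝ (Fin 3)) n, ‖lerayVorticity V s y‖ ^ 2) atTop
      (𝓝 (∫ y, ‖lerayVorticity V s y‖ ^ 2)) := by
    have h := tendsto_setIntegral_of_monotone (μ := (volume : Measure (EuclideanSpace ℝ (Fin 3))))
      (s := fun n : ℕ => closedBall (0 : EuclideanSpace ℝ (Fin 3)) n)
      (f := fun y => ‖lerayVorticity V s y‖ ^ 2) (fun n => measurableSet_closedBall)
      (fun m n hmn => closedBall_subset_closedBall (by exact_mod_cast hmn))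
      (by rw [iUnion_closedBall_nat]; exact (hΩi s).1.integrableOn)
    rwa [iUnion_closedBall_nat, Measure.restrict_univ] at h
  have hlim0 : Tendsto (fun n : ℕ => (κ * m + L / n * M) / (1 / 2)) atTop
      (𝓝 ((κ * m + 0 * M) / (1 / 2))) :=
    (((tendsto_const_div_atTop_nhds_zero_nat L).mul_const M).const_add _).div_const _
  have hE := le_of_tendsto_of_tendsto hlim hlim0 (Filter.eventually_atTop.2 ⟨1, fun n hn => hball n
      (by exact_mod_cast hn)⟩)
  have e : (κ * m + 0 * M) / (1 / 2) = 2 * κ * m := by ring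
  rwa [e] at hE

end Budget

/-! ### The rung: vorticity amplitude below `√3/4` forces `Ω ≡ 0`, hence `V ≡ 0` -/

section Rung

/-- **The similarity vorticity vanishes when the vorticity amplitude is below `√3/4`.** For
`V ∈ 𝒟_{C,K}` (any `C`, any `K`) with `(−t)‖curl V(t,x)‖ ≤ C_ω < √3/4` for all `t < 0` and all
`x`: `Ω ≡ 0`. The sharp stretching bound (`two_mul_integral_sqCutoff_stretching_le_sharp`,
`κ = (2/√3)C_ω`) and `integral_sq_norm_lerayVorticity_le_of_forall_le`, iterated from the law's bound
`∫‖Ω(s)‖² ≤ M = ‖curlCLM‖² max K 0`, give `∫‖Ω(s)‖² ≤ (4C_ω/√3)ⁿ M → 0`. [folklore energy method] -/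
theorem lerayVorticity_eq_zero_of_vorticity_lt (hV : IsTypeIAncientMild C V) {K : ℝ}
    (hK : ∀ t : ℝ, t < 0 → ∫⁻ x, ‖fderiv ℝ (V t) x‖ₑ ^ 2 ≤ ENNReal.ofReal (K / Real.sqrt (-t)))
    {Cω : ℝ} (hCω : Cω < Real.sqrt 3 / 4) (hω : ∀ t : ℝ, t < 0 → ∀ x, (-t) * ‖curl (V t) x‖ ≤ Cω) :
    ∀ s y, lerayVorticity V s y = 0 := by
  have hΩ : ∀ s y, ‖lerayVorticity V s y‖ ≤ Cω := fun s y =>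
    norm_lerayVorticity_le_of_vorticity_le hω s y
  have hCω0 : 0 ≤ Cω := (norm_nonneg _).trans (hΩ 0 0)
  have hΩi := fun σ => integrable_sq_norm_lerayVorticity hV hK σ
  set M : ℝ := ‖curlCLM‖ ^ 2 * max K 0 with hMdef
  -- the contraction ratio `r = 2κ = 4 C_ω/√3 < 1`
  set κ : ℝ := 2 * Cω * Real.sqrt 3 / 3 with hκdef
  have hκ0 : 0 ≤ κ := by positivity
  have h3 : Real.sqrt 3 ^ 2 = 3 := Real.sq_sqrt (by norm_num)
  have hs0 : 0 < Real.sqrt 3 := Real.sqrt_pos.2 (by norm_num)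
  have hr1 : 2 * κ < 1 := by
    rw [hκdef]
    have : Cω * Real.sqrt 3 < Real.sqrt 3 / 4 * Real.sqrt 3 := mul_lt_mul_of_pos_right hCω hs0
    nlinarith
  have hstr := fun σ (R : ℝ) (hR : 0 < R) =>
    two_mul_integral_sqCutoff_stretching_le_sharp hV hK hCω0 σ (hΩ σ) hR
  have hiter : ∀ n : ℕ, ∀ s, ∫ y, ‖lerayVorticity V s y‖ ^ 2 ≤ (2 * κ) ^ n * M := by
    intro n
    induction n with
    | zero => intro s; rw [pow_zero, one_mul]; exact (hΩi s).2
    | succ n ih =>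
        intro s
        calc ∫ y, ‖lerayVorticity V s y‖ ^ 2 ≤ 2 * κ * ((2 * κ) ^ n * M) :=
              integral_sq_norm_lerayVorticity_le_of_forall_le hV hK hκ0 hstr ih s
          _ = (2 * κ) ^ (n + 1) * M := by ring
  have hlim : Tendsto (fun n : ℕ => (2 * κ) ^ n * M) atTop (𝓝 (0 * M)) :=
    (tendsto_pow_atTop_nhds_zero_of_lt_one (by positivity) hr1).mul_const M
  rw [zero_mul] at hlim
  intro s
  have hcΩ : Continuous (lerayVorticity V s) :=
    (signedBudget_contDiff_lerayVorticity_slice hV s (n := 1)).continuous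
  have hE0 : ∫ y, ‖lerayVorticity V s y‖ ^ 2 ≤ 0 := ge_of_tendsto' hlim fun n => hiter n s
  have hE : ∫ y, ‖lerayVorticity V s y‖ ^ 2 = 0 :=
    le_antisymm hE0 (integral_nonneg fun y => sq_nonneg _)
  have hae : (fun y => ‖lerayVorticity V s y‖ ^ 2) =ᵐ[volume] 0 :=
    (integral_eq_zero_iff_of_nonneg (fun y => sq_nonneg _) (hΩi s).1).1 hE
  have hev : (fun y => ‖lerayVorticity V s y‖ ^ 2) = fun _ => (0 : ℝ) :=
    ((hcΩ.norm.pow 2).ae_eq_iff_eq (μ := volume) continuous_const).1 hae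
  intro y
  have hy := congrFun hev y
  have : ‖lerayVorticity V s y‖ = 0 := pow_eq_zero_iff (n := 2) (by norm_num) |>.1 hy
  exact norm_eq_zero.1 this

/-- **The vorticity-amplitude rung of the finite-dissipation stratum.** A Type-I ancient mild
solution `V` in the KNSS gauge (any constant `C`) obeying the quarter-rate dissipation law (any
constant `K`) whose vorticity satisfies `(−t)‖curl V(t,x)‖ ≤ C_ω` for all `t < 0`, `x`, with
`C_ω < √3/4`, vanishes identically on `t < 0`: `Ω ≡ 0` (`lerayVorticity_eq_zero_of_vorticity_lt`),
so every slice is curl- and divergence-free and bounded, hence constant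
(`eq_of_curl_eq_zero_of_isDivFree_of_bounded`), and the Oseen gauge kills constants
(`IsTypeIAncientMild.eq_zero_of_slice_const`). HONEST FRAMING: a Liouville statement about a
HYPOTHETICAL class with an explicit but unoptimised constant; nothing here bears on NS regularity.
[folklore energy method] -/
theorem eq_zero_of_vorticity_lt (hV : IsTypeIAncientMild C V) {K : ℝ}
    (hK : ∀ t : ℝ, t < 0 → ∫⁻ x, ‖fderiv ℝ (V t) x‖ₑ ^ 2 ≤ ENNReal.ofReal (K / Real.sqrt (-t)))
    {Cω : ℝ} (hCω : Cω < Real.sqrt 3 / 4) (hω : ∀ t : ℝ, t < 0 → ∀ x, (-t) * ‖curl (V t) x‖ ≤ Cω) :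
    ∀ t < 0, ∀ x, V t x = 0 := by
  have hΩ0 := lerayVorticity_eq_zero_of_vorticity_lt hV hK hCω hω
  have hcurl : ∀ t < 0, ∀ x, curl (V t) x = 0 := by
    intro t ht x
    set s : ℝ := -Real.log (-t) with hs
    have hts : -Real.exp (-s) = t := by
      rw [hs, neg_neg, Real.exp_log (neg_pos.2 ht), neg_neg]
    have h := hΩ0 s ((Real.exp (-s / 2))⁻¹ • x)
    rw [lerayVorticity_apply, curl_lerayOrbit, smul_smul,
      mul_inv_cancel₀ (Real.exp_pos _).ne', one_smul, hts, smul_eq_zero] at h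
    exact h.resolve_left (Real.exp_pos _).ne'
  have hconst : ∀ t < 0, ∀ x, V t x = V t 0 := fun t ht x =>
    eq_of_curl_eq_zero_of_isDivFree_of_bounded ((hV.contDiff_slice ht).of_le (by norm_cast))
      (hcurl t ht) (hV.isDivFree ht) (fun z => hV.norm_le ht z) x 0
  exact fun t ht x => hV.eq_zero_of_slice_const (b := fun t => V t 0) hconst ht x

/-- **Regularity form.** Under the same hypotheses `V` is bounded on a backward parabolic cylinder
at the space–time origin (indeed `V ≡ 0`), in the quantifier shape of the crux
`FiniteDissipationLiouville`. [folklore] -/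
theorem not_singular_of_vorticity_lt (hV : IsTypeIAncientMild C V) {K : ℝ}
    (hK : ∀ t : ℝ, t < 0 → ∫⁻ x, ‖fderiv ℝ (V t) x‖ₑ ^ 2 ≤ ENNReal.ofReal (K / Real.sqrt (-t)))
    {Cω : ℝ} (hCω : Cω < Real.sqrt 3 / 4) (hω : ∀ t : ℝ, t < 0 → ∀ x, (-t) * ‖curl (V t) x‖ ≤ Cω) :
    ¬ (∀ r > 0, ∀ M : ℝ, ∃ t ∈ Set.Ioo (-(r ^ 2)) (0 : ℝ),
        ∃ x ∈ Metric.ball (0 : EuclideanSpace ℝ (Fin 3)) r, M < ‖V t x‖) := by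
  intro hsing
  obtain ⟨t, ht, x, -, hM⟩ := hsing 1 one_pos 0
  have h0 := eq_zero_of_vorticity_lt hV hK hCω hω t ht.2 x
  rw [h0, norm_zero] at hM
  exact lt_irrefl _ hM

/-- **PORTRAIT: the vorticity of a finite-dissipation Type-I singularity reaches `(√3/4)(−t)⁻¹`.**
A SINGULAR member of `𝒟_{C,K}` (any `C`, `K`) has, for every `C_ω < √3/4`, an instant `t < 0` and a
point `x` with `C_ω < (−t)‖curl V(t,x)‖`: the scale-invariant vorticity amplitude
`sup_{t,x} (−t)‖ω‖` of the hypothetical minimal counterexample is at least `√3/4 ≈ 0.433` — the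
vorticity analogue of the velocity threshold `sup √(−t)‖V‖ ≥ 1` and of the dissipation threshold
`θ(K)⁴ ≥ 64/27`. No DSS scenario of the catalogued wall is removed. [folklore] -/
theorem vorticity_exceeds_of_singular (hV : IsTypeIAncientMild C V) {K : ℝ}
    (hK : ∀ t : ℝ, t < 0 → ∫⁻ x, ‖fderiv ℝ (V t) x‖ₑ ^ 2 ≤ ENNReal.ofReal (K / Real.sqrt (-t)))
    (hsing : ∀ r > 0, ∀ M : ℝ, ∃ t ∈ Set.Ioo (-(r ^ 2)) (0 : ℝ),
        ∃ x ∈ Metric.ball (0 : EuclideanSpace ℝ (Fin 3)) r, M < ‖V t x‖)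
    {Cω : ℝ} (hCω : Cω < Real.sqrt 3 / 4) :
    ∃ t : ℝ, t < 0 ∧ ∃ x, Cω < (-t) * ‖curl (V t) x‖ := by
  by_contra h
  push Not at h
  exact not_singular_of_vorticity_lt hV hK hCω (fun t ht x => h t ht x) hsing

end Rung

end Summit.NavierStokesRegularity.NavierStokesRegularity.Theorems.FiniteDissipationLiouville.VorticityAmplitude

end
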